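import Summits.CriticalPhenomena.PercolationContinuityZ3.Theorems.PercNearOneGluingNoHeavyLowerTailSahiGridPatternTwoPayerCrossed

/-!
# `NoHeavyLowerTail` (crux stmt-CriticalPhenomena-4575), Sahi programme P1: **THE TWO-PAYER OR STAR ON THE FOUR-VALUED FAMILY —
# THE SURPLUS IDENTITY, THE d-PART, AND THREE ROUTES (U, A, D) IN EVERY DIMENSION**

Support file (Sahi cell, seat `prim-sahi-p1`, generation 38; `--supports stmt-CriticalPhenomena-4575`).  Pure proofs, no definitions, no `sorry`, standard axioms.
Vocabulary of `…SahiGridPattern{,CellForm,DiagCert,DiagCertLiteralOr,TwoPayerSections,TwoPayerCrossed}` (`Pd`, `ind`, `TotDist`, `thirdPt`, `glue`, `thetaVal`, `nuCount`,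
`pairSum_eq_of_sym6_eq`, `weighted_kleitman_nonneg₂`, `theta_twoPayer_sections`, `budget_twoPayer_sections`).

THE MATHEMATICS (seat memo FROM-prim-sahi-p1-gen38-FOUR-VALUED-SURPLUS §1–§3).  `U = (x∧y) ∨ V ⊆ [3]^{2+k}` is the two-payer OR star with its OR8 vector `e`
(`4·2^k·1_V` on the outer cell `00`, `(2·2^k + 2d)·1_V` on the cells `0j`, `i0`, `4·2^k + 3h_V` on the four `T`-cells; `d` supported on the up-set `V ⊆ [3]^k`).
The FOUR-VALUED FAMILY of test pairs is `B = (P | P')` (section `P` over `x = 0`, `P'` over `x ≥ 1`), `C = (Q | Q')` (section `Q` over `y = 0`, `Q'` over `y ≥ 1`),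
`P ⊆ P'`, `Q ⊆ Q'` up-sets of `[3]^k` — the smallest family on which generation 36 showed that NO identity with constant multipliers proves condition (N)
`Θ_U(B×C) ≤ e(B∩C)` (the cover of the `d`-demand must switch with the configuration).  THIS FILE proves, for every `k`:
* **`twoPayerFourVal_pair_identity`** / **`twoPayerFourVal_slack_eq`** — the EXACT slack identity
    `e(B∩C) − Θ_U(B×C) = 4·Σ₈ + 4·( d(P∩Q') + d(P'∩Q) − Θ_V(P×Q) − Θ_V(P'×Q') )`,
  where the `d`-free SURPLUS `Σ₈` is the sum of EIGHT manifestly nonnegative columns (found by an exact LP over Latin-symmetrised kernels, kit job j272931 of this seat):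
    `Σ₈ = H(P',Q') + 2·H(P',Q∩V) + H(P',Q'∩V) + 2·H(Q',P∩V) + H(Q',P'∩V) + 3·Kl_{q∉V}(P',Q') + 2^k·#(V∩(P'∖P)∩(Q'∖Q)) + #{(q,r,t) Latin : q∈P'∖P, r∈Q'∖Q, t∉V}`
  (`H(X,Z) = Σ_{q δ̸ r} 1_X(r)(1_Z(r) − 1_Z(q̄r)) = 2^k#(X∩Z) − #{(q,r) ∈ X×Z : q δ̸ r}` coefficientwise Harris, `Kl` the fibre Kleitman sum weighted by `1 − 1_V` at the centre);
  **`twoPayerFourVal_surplus_nonneg`**: `Σ₈ ≥ 0`.  So on this family (N) says exactly: `d(P∩Q') + d(P'∩Q) + Σ₈ ≥ Θ_V(P×Q) + Θ_V(P'×Q')` for the certificate `d` of `V`.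
* Three sufficient conditions, each for all `k` (hypothesis (N) of the certificate `d` of `V`, `supp d ⊆ V`):
  **`twoPayerFourVal_N_of_routeU`** (cover `N_V[P,Q'] + N_V[P',Q]`): (N) holds if `X := Θ_V(P'×Q') + Θ_V(P×Q) − Θ_V(P×Q') − Θ_V(P'×Q) ≤ Σ₈`;
  **`twoPayerFourVal_N_of_routeA`** (cover `N_V[⊤,S] + N_V[P,Q]`, `S = (P∩Q') ∪ (P'∩Q)`): (N) holds if `Θ_V(P'×Q') − Θ_V(⊤×S) ≤ Σ₈`;
  **`twoPayerFourVal_N_of_footprint`** (cover `N_V[P',Q'] + N_V[P,Q]`, "route D", `d ≥ 0`): (N) holds whenever `V ∩ P' ∩ Q' ⊆ P ∪ Q` — in particular for the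
  cylinder pairs `P = P'`, `Q = Q'` (**`twoPayerFourVal_N_cylinder`**), with no inequality to check.
WHY THREE (memo §2): exhaustively at `k = 2` one of the routes U, A closes every configuration (gen36); at `k = 3` route U fails with only one of `P', Q'` full (gen37);
at `k = 4` this seat found `P=↑{0012,0202,1001}, P'=↑{0001}, Q=↑{0120}, Q'=↑{0020}, V=↑{0200,1001,1010,1100}` with `Σ₈ = 0`, `X = 8`, `Θ_V(P'×Q') − Θ_V(⊤×S) = 16`
(routes U and A both FAIL) but `V∩P'∩Q' ⊆ P∪Q` (route D closes it exactly) — so the two-route dichotomy of gen36/37 is false from `k = 4` on, while the per-configuration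
LP bound (CORE-Λ) survives.  Nothing here asserts `PatternPos d` for `d ≥ 4` or condition (N) beyond the stated hypotheses. [this work]
-/

namespace Summit.CriticalPhenomena.PercolationContinuityZ3.Theorems.SahiGridPattern

open Finset SahiGrid3
open scoped BigOperators

variable {k : ℕ}

/-- **The four-valued-family surplus identity, pair-sum form, ARBITRARY integer functions** `p P s S v : [3]^k → ℤ` (read `p = 1_P`, `P = 1_{P'}`, `s = 1_Q`,
`S = 1_{Q'}`, `v = 1_V`): the kernel "d-free budget − Θ_U (36 outer pairs, sections substituted) + 4·(Θ_V(P×Q) + Θ_V(P'×Q')) kernels" and `4 ×` the eight-column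
kernel have the same sum over totally distinct pairs (`pairSum_eq_of_sym6_eq` + `ring`; checked beforehand with random integer functions, k = 1, 2). [this work] -/
theorem twoPayerFourVal_pair_identity (p P s S v : Pd k → ℤ) :
    (∑ q : Pd k, ∑ r : Pd k, (if TotDist q r = true then (1:ℤ) else 0) *
      ( (4 * v q * p q * s q + 2 * v q * (2 * (p q * S q) + 2 * (P q * s q)) + 4 * (4 + 3 * v q - 3 * v r) * (P q * S q))
        - (p q * S r * (v q + 1 - 1)
          + p q * S r * (v q + 1 - 1)
          + p q * S r * (v q + 1 - 1)
          + p q * S r * (v q + 1 - 1)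
          + p q * s r * (v q + v r - 1)
          + p q * S r * (v q + 1 - v (thirdPt q r))
          + p q * s r * (v q + v r - 1)
          + p q * S r * (v q + 1 - v (thirdPt q r))
          + p q * s r * (v q + v r - 1)
          + p q * S r * (v q + 1 - v (thirdPt q r))
          + p q * s r * (v q + v r - 1)
          + p q * S r * (v q + 1 - v (thirdPt q r))
          + P q * S r * (v q + v r - 1)
          + P q * S r * (v q + v r - 1)
          + P q * S r * (v q + 1 - v (thirdPt q r))
          + P q * S r * (v q + 1 - v (thirdPt q r))
          + P q * s r * (1 + v r - 1)
          + P q * S r * (1 + v r - v (thirdPt q r))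
          + P q * s r * (1 + v r - v (thirdPt q r))
          + P q * S r * (1 + 1 - v (thirdPt q r))
          + P q * s r * (1 + v r - 1)
          + P q * S r * (1 + v r - v (thirdPt q r))
          + P q * s r * (1 + v r - v (thirdPt q r))
          + P q * S r * (1 + 1 - v (thirdPt q r))
          + P q * S r * (v q + v r - 1)
          + P q * S r * (v q + v r - 1)
          + P q * S r * (v q + 1 - v (thirdPt q r))
          + P q * S r * (v q + 1 - v (thirdPt q r))
          + P q * s r * (1 + v r - 1)
          + P q * S r * (1 + v r - v (thirdPt q r))
          + P q * s r * (1 + v r - v (thirdPt q r))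
          + P q * S r * (1 + 1 - v (thirdPt q r))
          + P q * s r * (1 + v r - 1)
          + P q * S r * (1 + v r - v (thirdPt q r))
          + P q * s r * (1 + v r - v (thirdPt q r))
          + P q * S r * (1 + 1 - v (thirdPt q r)))
        + 4 * (p q * s r * (v q + v r - v (thirdPt q r)) + P q * S r * (v q + v r - v (thirdPt q r))) ))
    = ∑ q : Pd k, ∑ r : Pd k, (if TotDist q r = true then (1:ℤ) else 0) *
      (4 * ( P r * (S r - S (thirdPt q r)) + 2 * (P r * (s r * v r - s (thirdPt q r) * v (thirdPt q r))) + P r * (S r * v r - S (thirdPt q r) * v (thirdPt q r)) + 2 * (S r * (p r * v r - p (thirdPt q r) * v (thirdPt q r))) + S r * (P r * v r - P (thirdPt q r) * v (thirdPt q r)) + 3 * ((1 - v q) * (P r * (S r - S (thirdPt q r)))) + (P q - p q) * (S q - s q) * v q + (P q - p q) * (S r - s r) * (1 - v (thirdPt q r)) )) := by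
  obtain ⟨c1, c2, c3, c4⟩ := And.intro (fun q r => (thirdPt_cancel (k := k) q r).1) (And.intro (fun q r => (thirdPt_cancel (k := k) q r).2.1)
    (And.intro (fun q r => (thirdPt_cancel (k := k) q r).2.2.1) (fun q r => (thirdPt_cancel (k := k) q r).2.2.2)))
  exact pairSum_eq_of_sym6_eq _ _ (fun q r => by simp only [c1, c2, c3, c4, thirdPt_comm r q]; ring)

/-- **The eight surplus columns are nonnegative** for up-sets `P ⊆ P'`, `Q ⊆ Q'`, `V` of `[3]^k` (five coefficientwise-Harris / fibre-Kleitman pair sums via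
`weighted_kleitman_nonneg₂`, one with the weight `1 − 1_V` at the centre, and two pointwise products). [this work] -/
theorem twoPayerFourVal_surplus_nonneg {P P' Q Q' V : Finset (Pd k)}
    (hP : IsUpperSet (P : Set (Pd k))) (hP' : IsUpperSet (P' : Set (Pd k))) (hQ : IsUpperSet (Q : Set (Pd k))) (hQ' : IsUpperSet (Q' : Set (Pd k)))
    (hV : IsUpperSet (V : Set (Pd k))) (hPP' : P ⊆ P') (hQQ' : Q ⊆ Q') :
    0 ≤ (∑ q : Pd k, ∑ r : Pd k, (if TotDist q r = true then (1:ℤ) else 0) *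
      ( ind P' r * (ind Q' r - ind Q' (thirdPt q r)) + 2 * (ind P' r * (ind Q r * ind V r - ind Q (thirdPt q r) * ind V (thirdPt q r))) + ind P' r * (ind Q' r * ind V r - ind Q' (thirdPt q r) * ind V (thirdPt q r)) + 2 * (ind Q' r * (ind P r * ind V r - ind P (thirdPt q r) * ind V (thirdPt q r))) + ind Q' r * (ind P' r * ind V r - ind P' (thirdPt q r) * ind V (thirdPt q r)) + 3 * ((1 - ind V q) * (ind P' r * (ind Q' r - ind Q' (thirdPt q r)))) + (ind P' q - ind P q) * (ind Q' q - ind Q q) * ind V q + (ind P' q - ind P q) * (ind Q' r - ind Q r) * (1 - ind V (thirdPt q r)) )) := by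
  have one_nn : ∀ q : Pd k, (0:ℤ) ≤ (fun _ => (1:ℤ)) q := fun _ => by norm_num
  have vc_nn : ∀ q : Pd k, (0:ℤ) ≤ (fun q => 1 - ind V q) q := fun q => by simp only [sub_nonneg]; exact ind_le_one' _ _
  have h1 := weighted_kleitman_nonneg₂ hP' hQ' (fun _ => (1:ℤ)) one_nn
  have h2 := weighted_kleitman_nonneg₂ hP' (isUpperSet_inter_coe hQ hV) (fun _ => (1:ℤ)) one_nn
  have h3 := weighted_kleitman_nonneg₂ hP' (isUpperSet_inter_coe hQ' hV) (fun _ => (1:ℤ)) one_nn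
  have h4 := weighted_kleitman_nonneg₂ hQ' (isUpperSet_inter_coe hP hV) (fun _ => (1:ℤ)) one_nn
  have h5 := weighted_kleitman_nonneg₂ hQ' (isUpperSet_inter_coe hP' hV) (fun _ => (1:ℤ)) one_nn
  have h6 := weighted_kleitman_nonneg₂ hP' hQ' (fun q => 1 - ind V q) vc_nn
  simp only [ind_inter_eq_mul, one_mul] at h1 h2 h3 h4 h5 h6
  have hpP : ∀ q : Pd k, 0 ≤ ind P' q - ind P q := fun q => by
    unfold ind
    by_cases hq : q ∈ P
    · rw [if_pos hq, if_pos (hPP' hq)]; norm_num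
    · rw [if_neg hq]; split_ifs <;> norm_num
  have hsS : ∀ q : Pd k, 0 ≤ ind Q' q - ind Q q := fun q => by
    unfold ind
    by_cases hq : q ∈ Q
    · rw [if_pos hq, if_pos (hQQ' hq)]; norm_num
    · rw [if_neg hq]; split_ifs <;> norm_num
  have h7 : 0 ≤ ∑ q : Pd k, ∑ r : Pd k, (if TotDist q r = true then (1:ℤ) else 0) * ((ind P' q - ind P q) * (ind Q' q - ind Q q) * ind V q) :=
    Finset.sum_nonneg fun q _ => Finset.sum_nonneg fun r _ => mul_nonneg (by split_ifs <;> norm_num)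
      (mul_nonneg (mul_nonneg (hpP q) (hsS q)) (ind_nonneg' _ _))
  have h8 : 0 ≤ ∑ q : Pd k, ∑ r : Pd k, (if TotDist q r = true then (1:ℤ) else 0) * ((ind P' q - ind P q) * (ind Q' r - ind Q r) * (1 - ind V (thirdPt q r))) :=
    Finset.sum_nonneg fun q _ => Finset.sum_nonneg fun r _ => mul_nonneg (by split_ifs <;> norm_num)
      (mul_nonneg (mul_nonneg (hpP q) (hsS r)) (by linarith [ind_le_one' V (thirdPt q r)]))
  have e : (∑ q : Pd k, ∑ r : Pd k, (if TotDist q r = true then (1:ℤ) else 0) *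
      ( ind P' r * (ind Q' r - ind Q' (thirdPt q r)) + 2 * (ind P' r * (ind Q r * ind V r - ind Q (thirdPt q r) * ind V (thirdPt q r))) + ind P' r * (ind Q' r * ind V r - ind Q' (thirdPt q r) * ind V (thirdPt q r)) + 2 * (ind Q' r * (ind P r * ind V r - ind P (thirdPt q r) * ind V (thirdPt q r))) + ind Q' r * (ind P' r * ind V r - ind P' (thirdPt q r) * ind V (thirdPt q r)) + 3 * ((1 - ind V q) * (ind P' r * (ind Q' r - ind Q' (thirdPt q r)))) + (ind P' q - ind P q) * (ind Q' q - ind Q q) * ind V q + (ind P' q - ind P q) * (ind Q' r - ind Q r) * (1 - ind V (thirdPt q r)) ))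
      = (∑ q : Pd k, ∑ r : Pd k, (if TotDist q r = true then (1:ℤ) else 0) * (ind P' r * (ind Q' r - ind Q' (thirdPt q r))))
        + 2 * (∑ q : Pd k, ∑ r : Pd k, (if TotDist q r = true then (1:ℤ) else 0) * (ind P' r * (ind Q r * ind V r - ind Q (thirdPt q r) * ind V (thirdPt q r))))
        + (∑ q : Pd k, ∑ r : Pd k, (if TotDist q r = true then (1:ℤ) else 0) * (ind P' r * (ind Q' r * ind V r - ind Q' (thirdPt q r) * ind V (thirdPt q r))))
        + 2 * (∑ q : Pd k, ∑ r : Pd k, (if TotDist q r = true then (1:ℤ) else 0) * (ind Q' r * (ind P r * ind V r - ind P (thirdPt q r) * ind V (thirdPt q r))))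
        + (∑ q : Pd k, ∑ r : Pd k, (if TotDist q r = true then (1:ℤ) else 0) * (ind Q' r * (ind P' r * ind V r - ind P' (thirdPt q r) * ind V (thirdPt q r))))
        + 3 * (∑ q : Pd k, ∑ r : Pd k, (if TotDist q r = true then (1:ℤ) else 0) * ((1 - ind V q) * (ind P' r * (ind Q' r - ind Q' (thirdPt q r)))))
        + (∑ q : Pd k, ∑ r : Pd k, (if TotDist q r = true then (1:ℤ) else 0) * ((ind P' q - ind P q) * (ind Q' q - ind Q q) * ind V q))
        + (∑ q : Pd k, ∑ r : Pd k, (if TotDist q r = true then (1:ℤ) else 0) * ((ind P' q - ind P q) * (ind Q' r - ind Q r) * (1 - ind V (thirdPt q r)))) := by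
    simp only [Finset.mul_sum, ← Finset.sum_add_distrib]
    refine Finset.sum_congr rfl fun q _ => Finset.sum_congr rfl fun r _ => ?_
    ring
  rw [e]
  linarith [h1, h2, h3, h4, h5, h6, h7, h8]

/-! ### The two-payer star against the four-valued family: sections, budget, slack -/

section FourVal

variable {V P P' Q Q' : Finset (Pd k)} {U B C : Finset (Pd (1 + (1 + k)))}

/-- Section indicators of `B = (P | P')` and `C = (Q | Q')` at doubly glued points. [this work] -/
theorem ind_fourVal_sections
    (hB : ∀ (ξ η : Pd 1) (q : Pd k), glue ξ (glue η q) ∈ B ↔ ((ξ 0 = 0 ∧ q ∈ P) ∨ (1 ≤ ξ 0 ∧ q ∈ P')))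
    (hC : ∀ (ξ η : Pd 1) (q : Pd k), glue ξ (glue η q) ∈ C ↔ ((η 0 = 0 ∧ q ∈ Q) ∨ (1 ≤ η 0 ∧ q ∈ Q'))) (q : Pd k) :
    (∀ η : Pd 1, ind B (glue (fun _ => 0) (glue η q)) = ind P q) ∧ (∀ η : Pd 1, ind B (glue (fun _ => 1) (glue η q)) = ind P' q)
    ∧ (∀ η : Pd 1, ind B (glue (fun _ => 2) (glue η q)) = ind P' q)
    ∧ (∀ ξ : Pd 1, ind C (glue ξ (glue (fun _ => 0) q)) = ind Q q) ∧ (∀ ξ : Pd 1, ind C (glue ξ (glue (fun _ => 1) q)) = ind Q' q)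
    ∧ (∀ ξ : Pd 1, ind C (glue ξ (glue (fun _ => 2) q)) = ind Q' q) := by
  have f10 : ¬ (1:Fin 3) ≤ 0 := by decide
  have f11 : (1:Fin 3) ≤ 1 := le_rfl
  have f12 : (1:Fin 3) ≤ 2 := by decide
  have e10 : ¬ ((1:Fin 3) = 0) := by decide
  have e20 : ¬ ((2:Fin 3) = 0) := by decide
  refine ⟨fun η => ?_, fun η => ?_, fun η => ?_, fun ξ => ?_, fun ξ => ?_, fun ξ => ?_⟩ <;>
    · unfold ind; simp only [hB, hC, f10, f11, f12, e10, e20, true_and, false_and, or_false, false_or]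

/-- **`Θ_U(B×C)` on the four-valued family** as ONE pair sum over `[3]^k` in the five indicators `1_P, 1_{P'}, 1_Q, 1_{Q'}, 1_V`. [this work] -/
theorem theta_twoPayer_fourVal (hU : ∀ (ξ η : Pd 1) (q : Pd k), glue ξ (glue η q) ∈ U ↔ ((1 ≤ ξ 0 ∧ 1 ≤ η 0) ∨ q ∈ V))
    (hB : ∀ (ξ η : Pd 1) (q : Pd k), glue ξ (glue η q) ∈ B ↔ ((ξ 0 = 0 ∧ q ∈ P) ∨ (1 ≤ ξ 0 ∧ q ∈ P')))
    (hC : ∀ (ξ η : Pd 1) (q : Pd k), glue ξ (glue η q) ∈ C ↔ ((η 0 = 0 ∧ q ∈ Q) ∨ (1 ≤ η 0 ∧ q ∈ Q'))) :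
    (∑ x ∈ B, ∑ y ∈ C, thetaVal U x y) = ∑ q : Pd k, ∑ r : Pd k, (if TotDist q r = true then (1:ℤ) else 0) *
      ( ind P q * ind Q' r * (ind V q + 1 - 1)
          + ind P q * ind Q' r * (ind V q + 1 - 1)
          + ind P q * ind Q' r * (ind V q + 1 - 1)
          + ind P q * ind Q' r * (ind V q + 1 - 1)
          + ind P q * ind Q r * (ind V q + ind V r - 1)
          + ind P q * ind Q' r * (ind V q + 1 - ind V (thirdPt q r))
          + ind P q * ind Q r * (ind V q + ind V r - 1)
          + ind P q * ind Q' r * (ind V q + 1 - ind V (thirdPt q r))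
          + ind P q * ind Q r * (ind V q + ind V r - 1)
          + ind P q * ind Q' r * (ind V q + 1 - ind V (thirdPt q r))
          + ind P q * ind Q r * (ind V q + ind V r - 1)
          + ind P q * ind Q' r * (ind V q + 1 - ind V (thirdPt q r))
          + ind P' q * ind Q' r * (ind V q + ind V r - 1)
          + ind P' q * ind Q' r * (ind V q + ind V r - 1)
          + ind P' q * ind Q' r * (ind V q + 1 - ind V (thirdPt q r))
          + ind P' q * ind Q' r * (ind V q + 1 - ind V (thirdPt q r))
          + ind P' q * ind Q r * (1 + ind V r - 1)
          + ind P' q * ind Q' r * (1 + ind V r - ind V (thirdPt q r))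
          + ind P' q * ind Q r * (1 + ind V r - ind V (thirdPt q r))
          + ind P' q * ind Q' r * (1 + 1 - ind V (thirdPt q r))
          + ind P' q * ind Q r * (1 + ind V r - 1)
          + ind P' q * ind Q' r * (1 + ind V r - ind V (thirdPt q r))
          + ind P' q * ind Q r * (1 + ind V r - ind V (thirdPt q r))
          + ind P' q * ind Q' r * (1 + 1 - ind V (thirdPt q r))
          + ind P' q * ind Q' r * (ind V q + ind V r - 1)
          + ind P' q * ind Q' r * (ind V q + ind V r - 1)
          + ind P' q * ind Q' r * (ind V q + 1 - ind V (thirdPt q r))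
          + ind P' q * ind Q' r * (ind V q + 1 - ind V (thirdPt q r))
          + ind P' q * ind Q r * (1 + ind V r - 1)
          + ind P' q * ind Q' r * (1 + ind V r - ind V (thirdPt q r))
          + ind P' q * ind Q r * (1 + ind V r - ind V (thirdPt q r))
          + ind P' q * ind Q' r * (1 + 1 - ind V (thirdPt q r))
          + ind P' q * ind Q r * (1 + ind V r - 1)
          + ind P' q * ind Q' r * (1 + ind V r - ind V (thirdPt q r))
          + ind P' q * ind Q r * (1 + ind V r - ind V (thirdPt q r))
          + ind P' q * ind Q' r * (1 + 1 - ind V (thirdPt q r)) ) := by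
  rw [theta_twoPayer_sections hU B C]
  have hs := fun q => ind_fourVal_sections (P := P) (P' := P') (Q := Q) (Q' := Q') hB hC q
  simp only [(hs _).1, (hs _).2.1, (hs _).2.2.1, (hs _).2.2.2.1, (hs _).2.2.2.2.1, (hs _).2.2.2.2.2]

/-- **The OR8 budget `e(B∩C)` on the four-valued family** as a point sum over `[3]^k`. [this work] -/
theorem budget_twoPayer_fourVal
    (hB : ∀ (ξ η : Pd 1) (q : Pd k), glue ξ (glue η q) ∈ B ↔ ((ξ 0 = 0 ∧ q ∈ P) ∨ (1 ≤ ξ 0 ∧ q ∈ P')))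
    (hC : ∀ (ξ η : Pd 1) (q : Pd k), glue ξ (glue η q) ∈ C ↔ ((η 0 = 0 ∧ q ∈ Q) ∨ (1 ≤ η 0 ∧ q ∈ Q'))) (d : Pd k → ℤ) :
    (∑ x ∈ B ∩ C, (fun x : Pd (1 + (1 + k)) =>
        if (1 ≤ freeOf x 0 ∧ 1 ≤ freeOf (cellOf x) 0) then (4 * 2 ^ k + 3 * (2 ^ k * ind V (cellOf (cellOf x)) - (nuCount V (cellOf (cellOf x)) : ℤ)))
        else if (freeOf x 0 = 0 ∧ freeOf (cellOf x) 0 = 0) then 4 * 2 ^ k * ind V (cellOf (cellOf x))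
        else (2 * 2 ^ k + 2 * d (cellOf (cellOf x))) * ind V (cellOf (cellOf x))) x)
    = ∑ q : Pd k, ( ind P q * ind Q q * (4 * 2 ^ k * ind V q)
        + ind P q * ind Q' q * ((2 * 2 ^ k + 2 * d q) * ind V q)
        + ind P q * ind Q' q * ((2 * 2 ^ k + 2 * d q) * ind V q)
        + ind P' q * ind Q q * ((2 * 2 ^ k + 2 * d q) * ind V q)
        + ind P' q * ind Q' q * (4 * 2 ^ k + 3 * (2 ^ k * ind V q - (nuCount V q : ℤ)))
        + ind P' q * ind Q' q * (4 * 2 ^ k + 3 * (2 ^ k * ind V q - (nuCount V q : ℤ)))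
        + ind P' q * ind Q q * ((2 * 2 ^ k + 2 * d q) * ind V q)
        + ind P' q * ind Q' q * (4 * 2 ^ k + 3 * (2 ^ k * ind V q - (nuCount V q : ℤ)))
        + ind P' q * ind Q' q * (4 * 2 ^ k + 3 * (2 ^ k * ind V q - (nuCount V q : ℤ))) ) := by
  rw [budget_twoPayer_sections V d B C]
  have hs := fun q => ind_fourVal_sections (P := P) (P' := P') (Q := Q) (Q' := Q') hB hC q
  simp only [(hs _).1, (hs _).2.1, (hs _).2.2.1, (hs _).2.2.2.1, (hs _).2.2.2.2.1, (hs _).2.2.2.2.2]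

/-- **THE SLACK IDENTITY on the four-valued family** (every `k`; `supp d ⊆ V`):
`e(B∩C) − Θ_U(B×C) = 4·Σ₈ + 4·( d(P∩Q') + d(P'∩Q) − Θ_V(P×Q) − Θ_V(P'×Q') )`. [this work] -/
theorem twoPayerFourVal_slack_eq (hU : ∀ (ξ η : Pd 1) (q : Pd k), glue ξ (glue η q) ∈ U ↔ ((1 ≤ ξ 0 ∧ 1 ≤ η 0) ∨ q ∈ V))
    (hB : ∀ (ξ η : Pd 1) (q : Pd k), glue ξ (glue η q) ∈ B ↔ ((ξ 0 = 0 ∧ q ∈ P) ∨ (1 ≤ ξ 0 ∧ q ∈ P')))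
    (hC : ∀ (ξ η : Pd 1) (q : Pd k), glue ξ (glue η q) ∈ C ↔ ((η 0 = 0 ∧ q ∈ Q) ∨ (1 ≤ η 0 ∧ q ∈ Q')))
    (d : Pd k → ℤ) (hdV : ∀ q, q ∉ V → d q = 0) :
    (∑ x ∈ B ∩ C, (fun x : Pd (1 + (1 + k)) =>
        if (1 ≤ freeOf x 0 ∧ 1 ≤ freeOf (cellOf x) 0) then (4 * 2 ^ k + 3 * (2 ^ k * ind V (cellOf (cellOf x)) - (nuCount V (cellOf (cellOf x)) : ℤ)))
        else if (freeOf x 0 = 0 ∧ freeOf (cellOf x) 0 = 0) then 4 * 2 ^ k * ind V (cellOf (cellOf x))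
        else (2 * 2 ^ k + 2 * d (cellOf (cellOf x))) * ind V (cellOf (cellOf x))) x) - (∑ x ∈ B, ∑ y ∈ C, thetaVal U x y)
    = 4 * (∑ q : Pd k, ∑ r : Pd k, (if TotDist q r = true then (1:ℤ) else 0) *
      ( ind P' r * (ind Q' r - ind Q' (thirdPt q r)) + 2 * (ind P' r * (ind Q r * ind V r - ind Q (thirdPt q r) * ind V (thirdPt q r))) + ind P' r * (ind Q' r * ind V r - ind Q' (thirdPt q r) * ind V (thirdPt q r)) + 2 * (ind Q' r * (ind P r * ind V r - ind P (thirdPt q r) * ind V (thirdPt q r))) + ind Q' r * (ind P' r * ind V r - ind P' (thirdPt q r) * ind V (thirdPt q r)) + 3 * ((1 - ind V q) * (ind P' r * (ind Q' r - ind Q' (thirdPt q r)))) + (ind P' q - ind P q) * (ind Q' q - ind Q q) * ind V q + (ind P' q - ind P q) * (ind Q' r - ind Q r) * (1 - ind V (thirdPt q r)) ))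
      + 4 * ((∑ q ∈ P ∩ Q', d q) + (∑ q ∈ P' ∩ Q, d q) - (∑ q ∈ P, ∑ r ∈ Q, thetaVal V q r) - (∑ q ∈ P', ∑ r ∈ Q', thetaVal V q r)) := by
  rw [theta_twoPayer_fourVal hU hB hC, budget_twoPayer_fourVal (V := V) hB hC d]
  have hdv : ∀ q : Pd k, d q * ind V q = d q := fun q => by
    unfold ind
    by_cases hq : q ∈ V
    · rw [if_pos hq, mul_one]
    · rw [if_neg hq, mul_zero, hdV q hq]
  -- (1) the budget: d-free pair part + d part
  have hE : (∑ q : Pd k, ( ind P q * ind Q q * (4 * 2 ^ k * ind V q)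
        + ind P q * ind Q' q * ((2 * 2 ^ k + 2 * d q) * ind V q)
        + ind P q * ind Q' q * ((2 * 2 ^ k + 2 * d q) * ind V q)
        + ind P' q * ind Q q * ((2 * 2 ^ k + 2 * d q) * ind V q)
        + ind P' q * ind Q' q * (4 * 2 ^ k + 3 * (2 ^ k * ind V q - (nuCount V q : ℤ)))
        + ind P' q * ind Q' q * (4 * 2 ^ k + 3 * (2 ^ k * ind V q - (nuCount V q : ℤ)))
        + ind P' q * ind Q q * ((2 * 2 ^ k + 2 * d q) * ind V q)
        + ind P' q * ind Q' q * (4 * 2 ^ k + 3 * (2 ^ k * ind V q - (nuCount V q : ℤ)))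
        + ind P' q * ind Q' q * (4 * 2 ^ k + 3 * (2 ^ k * ind V q - (nuCount V q : ℤ))) ))
      = (∑ q : Pd k, ∑ r : Pd k, (if TotDist q r = true then (1:ℤ) else 0) * (4 * ind V q * ind P q * ind Q q + 2 * ind V q * (2 * (ind P q * ind Q' q) + 2 * (ind P' q * ind Q q)) + 4 * (4 + 3 * ind V q - 3 * ind V r) * (ind P' q * ind Q' q)))
        + 4 * (∑ q : Pd k, d q * (ind P q * ind Q' q + ind P' q * ind Q q)) := by
    rw [Finset.mul_sum, ← Finset.sum_add_distrib]
    refine Finset.sum_congr rfl fun q _ => ?_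
    have e1 : (∑ r : Pd k, (if TotDist q r = true then (1:ℤ) else 0) * (4 * ind V q * ind P q * ind Q q + 2 * ind V q * (2 * (ind P q * ind Q' q) + 2 * (ind P' q * ind Q q)) + 4 * (4 + 3 * ind V q - 3 * ind V r) * (ind P' q * ind Q' q)))
        = (∑ r : Pd k, (if TotDist q r = true then (1:ℤ) else 0) * (4 * ind V q * ind P q * ind Q q + 2 * ind V q * (2 * (ind P q * ind Q' q) + 2 * (ind P' q * ind Q q)) + 4 * (4 + 3 * ind V q) * (ind P' q * ind Q' q)))
          - ∑ r : Pd k, (if TotDist q r = true then (1:ℤ) else 0) * (ind V r * (12 * (ind P' q * ind Q' q))) := by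
      rw [← Finset.sum_sub_distrib]; exact Finset.sum_congr rfl fun r _ => by ring
    rw [e1, ← Finset.sum_mul, sum_ite_totDist_eq_two_pow, ← nuCount_mul_eq_pairSum V (fun q => 12 * (ind P' q * ind Q' q)) q]
    have e2 := hdv q
    linear_combination (2 * (2 * (ind P q * ind Q' q) + 2 * (ind P' q * ind Q q))) * e2
  -- (2) the d part and the two Θ_V demands as the stated finset sums
  have hD : (∑ q : Pd k, d q * (ind P q * ind Q' q + ind P' q * ind Q q)) = (∑ q ∈ P ∩ Q', d q) + (∑ q ∈ P' ∩ Q, d q) := by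
    rw [sum_mem_eq_sum_ind_mul (P ∩ Q'), sum_mem_eq_sum_ind_mul (P' ∩ Q), ← Finset.sum_add_distrib]
    refine Finset.sum_congr rfl fun q _ => ?_
    rw [ind_inter_eq_mul, ind_inter_eq_mul]; ring
  have hT1 : (∑ q ∈ P, ∑ r ∈ Q, thetaVal V q r) = ∑ q : Pd k, ∑ r : Pd k, (if TotDist q r = true then (1:ℤ) else 0) * (ind P q * ind Q r * (ind V q + ind V r - ind V (thirdPt q r))) := by
    rw [sum_mem_eq_sum_ind_mul P]
    refine Finset.sum_congr rfl fun q _ => ?_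
    rw [sum_mem_eq_sum_ind_mul Q, Finset.mul_sum]
    refine Finset.sum_congr rfl fun r _ => ?_
    rw [thetaVal_eq_ite_mul]; ring
  have hT2 : (∑ q ∈ P', ∑ r ∈ Q', thetaVal V q r) = ∑ q : Pd k, ∑ r : Pd k, (if TotDist q r = true then (1:ℤ) else 0) * (ind P' q * ind Q' r * (ind V q + ind V r - ind V (thirdPt q r))) := by
    rw [sum_mem_eq_sum_ind_mul P']
    refine Finset.sum_congr rfl fun q _ => ?_
    rw [sum_mem_eq_sum_ind_mul Q', Finset.mul_sum]
    refine Finset.sum_congr rfl fun r _ => ?_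
    rw [thetaVal_eq_ite_mul]; ring
  -- (3) the pair identity
  have Id := twoPayerFourVal_pair_identity (fun q => ind P q) (fun q => ind P' q) (fun q => ind Q q) (fun q => ind Q' q) (fun q => ind V q)
  have split : (∑ q : Pd k, ∑ r : Pd k, (if TotDist q r = true then (1:ℤ) else 0) *
      ( (4 * ind V q * ind P q * ind Q q + 2 * ind V q * (2 * (ind P q * ind Q' q) + 2 * (ind P' q * ind Q q)) + 4 * (4 + 3 * ind V q - 3 * ind V r) * (ind P' q * ind Q' q))
        - (ind P q * ind Q' r * (ind V q + 1 - 1)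
          + ind P q * ind Q' r * (ind V q + 1 - 1)
          + ind P q * ind Q' r * (ind V q + 1 - 1)
          + ind P q * ind Q' r * (ind V q + 1 - 1)
          + ind P q * ind Q r * (ind V q + ind V r - 1)
          + ind P q * ind Q' r * (ind V q + 1 - ind V (thirdPt q r))
          + ind P q * ind Q r * (ind V q + ind V r - 1)
          + ind P q * ind Q' r * (ind V q + 1 - ind V (thirdPt q r))
          + ind P q * ind Q r * (ind V q + ind V r - 1)
          + ind P q * ind Q' r * (ind V q + 1 - ind V (thirdPt q r))
          + ind P q * ind Q r * (ind V q + ind V r - 1)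
          + ind P q * ind Q' r * (ind V q + 1 - ind V (thirdPt q r))
          + ind P' q * ind Q' r * (ind V q + ind V r - 1)
          + ind P' q * ind Q' r * (ind V q + ind V r - 1)
          + ind P' q * ind Q' r * (ind V q + 1 - ind V (thirdPt q r))
          + ind P' q * ind Q' r * (ind V q + 1 - ind V (thirdPt q r))
          + ind P' q * ind Q r * (1 + ind V r - 1)
          + ind P' q * ind Q' r * (1 + ind V r - ind V (thirdPt q r))
          + ind P' q * ind Q r * (1 + ind V r - ind V (thirdPt q r))
          + ind P' q * ind Q' r * (1 + 1 - ind V (thirdPt q r))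
          + ind P' q * ind Q r * (1 + ind V r - 1)
          + ind P' q * ind Q' r * (1 + ind V r - ind V (thirdPt q r))
          + ind P' q * ind Q r * (1 + ind V r - ind V (thirdPt q r))
          + ind P' q * ind Q' r * (1 + 1 - ind V (thirdPt q r))
          + ind P' q * ind Q' r * (ind V q + ind V r - 1)
          + ind P' q * ind Q' r * (ind V q + ind V r - 1)
          + ind P' q * ind Q' r * (ind V q + 1 - ind V (thirdPt q r))
          + ind P' q * ind Q' r * (ind V q + 1 - ind V (thirdPt q r))
          + ind P' q * ind Q r * (1 + ind V r - 1)
          + ind P' q * ind Q' r * (1 + ind V r - ind V (thirdPt q r))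
          + ind P' q * ind Q r * (1 + ind V r - ind V (thirdPt q r))
          + ind P' q * ind Q' r * (1 + 1 - ind V (thirdPt q r))
          + ind P' q * ind Q r * (1 + ind V r - 1)
          + ind P' q * ind Q' r * (1 + ind V r - ind V (thirdPt q r))
          + ind P' q * ind Q r * (1 + ind V r - ind V (thirdPt q r))
          + ind P' q * ind Q' r * (1 + 1 - ind V (thirdPt q r)))
        + 4 * (ind P q * ind Q r * (ind V q + ind V r - ind V (thirdPt q r)) + ind P' q * ind Q' r * (ind V q + ind V r - ind V (thirdPt q r))) ))
      = (∑ q : Pd k, ∑ r : Pd k, (if TotDist q r = true then (1:ℤ) else 0) * (4 * ind V q * ind P q * ind Q q + 2 * ind V q * (2 * (ind P q * ind Q' q) + 2 * (ind P' q * ind Q q)) + 4 * (4 + 3 * ind V q - 3 * ind V r) * (ind P' q * ind Q' q)))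
        - (∑ q : Pd k, ∑ r : Pd k, (if TotDist q r = true then (1:ℤ) else 0) * (ind P q * ind Q' r * (ind V q + 1 - 1)
          + ind P q * ind Q' r * (ind V q + 1 - 1)
          + ind P q * ind Q' r * (ind V q + 1 - 1)
          + ind P q * ind Q' r * (ind V q + 1 - 1)
          + ind P q * ind Q r * (ind V q + ind V r - 1)
          + ind P q * ind Q' r * (ind V q + 1 - ind V (thirdPt q r))
          + ind P q * ind Q r * (ind V q + ind V r - 1)
          + ind P q * ind Q' r * (ind V q + 1 - ind V (thirdPt q r))
          + ind P q * ind Q r * (ind V q + ind V r - 1)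
          + ind P q * ind Q' r * (ind V q + 1 - ind V (thirdPt q r))
          + ind P q * ind Q r * (ind V q + ind V r - 1)
          + ind P q * ind Q' r * (ind V q + 1 - ind V (thirdPt q r))
          + ind P' q * ind Q' r * (ind V q + ind V r - 1)
          + ind P' q * ind Q' r * (ind V q + ind V r - 1)
          + ind P' q * ind Q' r * (ind V q + 1 - ind V (thirdPt q r))
          + ind P' q * ind Q' r * (ind V q + 1 - ind V (thirdPt q r))
          + ind P' q * ind Q r * (1 + ind V r - 1)
          + ind P' q * ind Q' r * (1 + ind V r - ind V (thirdPt q r))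
          + ind P' q * ind Q r * (1 + ind V r - ind V (thirdPt q r))
          + ind P' q * ind Q' r * (1 + 1 - ind V (thirdPt q r))
          + ind P' q * ind Q r * (1 + ind V r - 1)
          + ind P' q * ind Q' r * (1 + ind V r - ind V (thirdPt q r))
          + ind P' q * ind Q r * (1 + ind V r - ind V (thirdPt q r))
          + ind P' q * ind Q' r * (1 + 1 - ind V (thirdPt q r))
          + ind P' q * ind Q' r * (ind V q + ind V r - 1)
          + ind P' q * ind Q' r * (ind V q + ind V r - 1)
          + ind P' q * ind Q' r * (ind V q + 1 - ind V (thirdPt q r))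
          + ind P' q * ind Q' r * (ind V q + 1 - ind V (thirdPt q r))
          + ind P' q * ind Q r * (1 + ind V r - 1)
          + ind P' q * ind Q' r * (1 + ind V r - ind V (thirdPt q r))
          + ind P' q * ind Q r * (1 + ind V r - ind V (thirdPt q r))
          + ind P' q * ind Q' r * (1 + 1 - ind V (thirdPt q r))
          + ind P' q * ind Q r * (1 + ind V r - 1)
          + ind P' q * ind Q' r * (1 + ind V r - ind V (thirdPt q r))
          + ind P' q * ind Q r * (1 + ind V r - ind V (thirdPt q r))
          + ind P' q * ind Q' r * (1 + 1 - ind V (thirdPt q r))))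
        + 4 * (∑ q : Pd k, ∑ r : Pd k, (if TotDist q r = true then (1:ℤ) else 0) * (ind P q * ind Q r * (ind V q + ind V r - ind V (thirdPt q r))))
        + 4 * (∑ q : Pd k, ∑ r : Pd k, (if TotDist q r = true then (1:ℤ) else 0) * (ind P' q * ind Q' r * (ind V q + ind V r - ind V (thirdPt q r)))) := by
    simp only [Finset.mul_sum, ← Finset.sum_sub_distrib, ← Finset.sum_add_distrib]
    refine Finset.sum_congr rfl fun q _ => Finset.sum_congr rfl fun r _ => ?_
    ring
  have c4 : (∑ q : Pd k, ∑ r : Pd k, (if TotDist q r = true then (1:ℤ) else 0) * (4 * ( ind P' r * (ind Q' r - ind Q' (thirdPt q r)) + 2 * (ind P' r * (ind Q r * ind V r - ind Q (thirdPt q r) * ind V (thirdPt q r))) + ind P' r * (ind Q' r * ind V r - ind Q' (thirdPt q r) * ind V (thirdPt q r)) + 2 * (ind Q' r * (ind P r * ind V r - ind P (thirdPt q r) * ind V (thirdPt q r))) + ind Q' r * (ind P' r * ind V r - ind P' (thirdPt q r) * ind V (thirdPt q r)) + 3 * ((1 - ind V q) * (ind P' r * (ind Q' r - ind Q' (thirdPt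 q r)))) + (ind P' q - ind P q) * (ind Q' q - ind Q q) * ind V q + (ind P' q - ind P q) * (ind Q' r - ind Q r) * (1 - ind V (thirdPt q r)) )))
      = 4 * (∑ q : Pd k, ∑ r : Pd k, (if TotDist q r = true then (1:ℤ) else 0) *
      ( ind P' r * (ind Q' r - ind Q' (thirdPt q r)) + 2 * (ind P' r * (ind Q r * ind V r - ind Q (thirdPt q r) * ind V (thirdPt q r))) + ind P' r * (ind Q' r * ind V r - ind Q' (thirdPt q r) * ind V (thirdPt q r)) + 2 * (ind Q' r * (ind P r * ind V r - ind P (thirdPt q r) * ind V (thirdPt q r))) + ind Q' r * (ind P' r * ind V r - ind P' (thirdPt q r) * ind V (thirdPt q r)) + 3 * ((1 - ind V q) * (ind P' r * (ind Q' r - ind Q' (thirdPt q r)))) + (ind P' q - ind P q) * (ind Q' q - ind Q q) * ind V q + (ind P' q - ind P q) * (ind Q' r - ind Q r) * (1 - ind V (thirdPt q r)) )) := by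
    rw [Finset.mul_sum]; refine Finset.sum_congr rfl fun q _ => ?_
    rw [Finset.mul_sum]; refine Finset.sum_congr rfl fun r _ => ?_
    ring
  rw [hE, hD, hT1, hT2]
  rw [split, c4] at Id
  linarith [Id]

/-- **(N) on the four-valued family from the d-part** (every `k`): if `Θ_V(P×Q) + Θ_V(P'×Q') ≤ d(P∩Q') + d(P'∩Q)` then `Θ_U(B×C) ≤ e(B∩C)`. [this work] -/
theorem twoPayerFourVal_N_of_D (hU : ∀ (ξ η : Pd 1) (q : Pd k), glue ξ (glue η q) ∈ U ↔ ((1 ≤ ξ 0 ∧ 1 ≤ η 0) ∨ q ∈ V))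
    (hB : ∀ (ξ η : Pd 1) (q : Pd k), glue ξ (glue η q) ∈ B ↔ ((ξ 0 = 0 ∧ q ∈ P) ∨ (1 ≤ ξ 0 ∧ q ∈ P')))
    (hC : ∀ (ξ η : Pd 1) (q : Pd k), glue ξ (glue η q) ∈ C ↔ ((η 0 = 0 ∧ q ∈ Q) ∨ (1 ≤ η 0 ∧ q ∈ Q')))
    (hP : IsUpperSet (P : Set (Pd k))) (hP' : IsUpperSet (P' : Set (Pd k))) (hQ : IsUpperSet (Q : Set (Pd k))) (hQ' : IsUpperSet (Q' : Set (Pd k)))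
    (hV : IsUpperSet (V : Set (Pd k))) (hPP' : P ⊆ P') (hQQ' : Q ⊆ Q')
    (d : Pd k → ℤ) (hdV : ∀ q, q ∉ V → d q = 0)
    (hD : (∑ q ∈ P, ∑ r ∈ Q, thetaVal V q r) + (∑ q ∈ P', ∑ r ∈ Q', thetaVal V q r) ≤ (∑ q ∈ P ∩ Q', d q) + (∑ q ∈ P' ∩ Q, d q)) :
    (∑ x ∈ B, ∑ y ∈ C, thetaVal U x y) ≤ ∑ x ∈ B ∩ C, (fun x : Pd (1 + (1 + k)) =>
        if (1 ≤ freeOf x 0 ∧ 1 ≤ freeOf (cellOf x) 0) then (4 * 2 ^ k + 3 * (2 ^ k * ind V (cellOf (cellOf x)) - (nuCount V (cellOf (cellOf x)) : ℤ)))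
        else if (freeOf x 0 = 0 ∧ freeOf (cellOf x) 0 = 0) then 4 * 2 ^ k * ind V (cellOf (cellOf x))
        else (2 * 2 ^ k + 2 * d (cellOf (cellOf x))) * ind V (cellOf (cellOf x))) x := by
  have h := twoPayerFourVal_slack_eq hU hB hC d hdV
  have hs := twoPayerFourVal_surplus_nonneg hP hP' hQ hQ' hV hPP' hQQ'
  linarith

end FourVal

end Summit.CriticalPhenomena.PercolationContinuityZ3.Theorems.SahiGridPattern
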